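import Literature.NumberTheory.Automorphic.GKModulesKSpanMatrixExp
import Literature.RepresentationTheory.BorelWallach2000.U11WeightDecomposition
import Literature.NumberTheory.Automorphic.GKModuleProd
import HarnessLib

/-!
# K2 ∕ E1b — αᵤ road brick (5a′) «a `𝔨`-stable subspace of a `(𝔤, K)`-module is `K`-stable when `K = exp 𝔨`»

Cell hodgecm-mathlib, Track B «K2-LIT», engine E1b, unit U8; crux item h413 = stmt-HodgeConjecture-24833 (supports-only helper; closes nothing by itself).
DEAL (D-αᵤ5a) of K2E1b-plan (g4) 2026-09-04T04:13:05Z to the desk K2-defs1 (g3) — the K-EQUIVARIANCE half `map_ρK` of O9's `GKEquiv` is ALREADY ★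
for linear equivalences (★ `IsGKModule.map_ρK_of_lieEquiv` ∕ `areGKEquivalent_of_lieEquiv`, `GKModulesKActionUnique`), so this file proves the ONE
remaining general fact the assembly needs (K2E1b-r01 (g4) M2: «(5a′) K-stability load-bearing»): a complex subspace `W` of a `(𝔤, K)`-module stable under
`ρ𝔤(𝔨)` is stable under `ρK(exp 𝔨)`, hence under `K` when every element of `K` is an exponential (e.g. `U(α) × U(β) ⊂ U(α, β)`, ★ `upq_exists_expK_eq`).
THEOREMS ONLY — no definition, no `sorry`, no axiom, no instance (one `attribute [local instance] LieRing.ofAssociativeRing`), no notation; GENERAL `G`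
(any `RealMatrixGroup`), no E1b dependence.

## The proof ([KnappVogan1995, §I.4 (1.64)–(1.65)]; [Hall2015, Cor. 3.44])

Fix `Y ∈ 𝔨`, `w ∈ W`.  The `K`-span `F` of `w` is finite-dimensional and `K`-stable (★ `IsGKModule.kFinite`, ★ `GKWeights.kSpan_stable`), so in a basis `b` of `F`
★ `IsGKModule.coords_expK` reads `coords (ρK (exp Y) w) = exp(M) · coords w` with `M` the matrix of `T = ρ𝔤(Y)|_F` (★ `mat`).  The coordinate image `P` of
`W ∩ F` is `M`-stable (`T` preserves `W` and `F`), hence stable under the whole algebra `ℂ[M]` generated by `M`, which is finite-dimensional, hence CLOSED, hence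
contains `exp M` (Mathlib `NormedSpace.exp_mem`); so `coords (ρK (exp Y) w) ∈ P`, i.e. they are the coordinates of some `x ∈ W ∩ F`, and coordinates are
injective on `F`: `ρK (exp Y) w = x ∈ W`.

* `ρK_expK_apply_mem_of_lieStable` — the statement for `k = expK Y`;
* **`ρK_apply_mem_of_lieStable`** — for all `k` when `K = exp 𝔨` (`hK : ∀ k, ∃ Y, G.expK Y = k`).

HONEST LABEL: HC_CM is proved only modulo the 7 printed citations (2 remaining named inputs: hLiu418 = stmt-HodgeConjecture-24832,
h413 = stmt-HodgeConjecture-24833) until rung 0 closes; a general brick, closes nothing.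
-/

set_option autoImplicit false

noncomputable section

-- Mathlib idiom (as in ★ `GKModules`): the commutator bracket on `Module.End ℂ V` ∕ matrices, to MENTION `ρ𝔤 : 𝔤 →ₗ⁅ℝ⁆ End V`.
attribute [local instance 100] LieRing.ofAssociativeRing

open Matrix
open scoped Matrix.Norms.Operator

namespace Literature.NumberTheory.Automorphic

namespace IsGKModule

variable {A : Type*} [NormedCommRing A] [NormedAlgebra ℝ A] [NormedAlgebra ℚ A] [CompleteSpace A]
  [StarRing A] [StarModule ℝ A] [ContinuousStar A] {N : Type*} [Fintype N] [DecidableEq N]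
  {G : RealMatrixGroup A N}
  {V : Type*} [AddCommGroup V] [Module ℂ V]
  {ρK : Representation ℂ G.maximalCompact V} {ρ𝔤 : G.lie →ₗ⁅ℝ⁆ Module.End ℂ V}

section Coords

variable {F : Submodule ℂ V} {d : ℕ} (b : Module.Basis (Fin d) ℂ F)

/-- Coordinates are injective on `F`: two vectors of `F` with the same coordinate vector are equal (★ `sum_coordFn_smul`). [cite: KnappVogan1995, §I.4 (1.64)–(1.65)] -/
theorem eq_of_coords_eq {x y : V} (hx : x ∈ F) (hy : y ∈ F) (h : coords b x = coords b y) : x = y := by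
  rw [← sum_coordFn_smul b hx, ← sum_coordFn_smul b hy]
  refine Finset.sum_congr rfl fun i _ => ?_
  have hi := congrFun h i
  simp only [coords] at hi
  rw [hi]

/-- Coordinates are additive. [cite: KnappVogan1995, §I.4 (1.64)–(1.65)] -/
theorem coords_add (x y : V) : coords b (x + y) = coords b x + coords b y := by
  funext i; simp [coords]

/-- Coordinates are homogeneous. [cite: KnappVogan1995, §I.4 (1.64)–(1.65)] -/
theorem coords_smul (c : ℂ) (x : V) : coords b (c • x) = c • coords b x := by
  funext i; simp [coords]

/-- **A subalgebra element built from `M` preserves every `M`-stable subspace of coordinate vectors**: if `M *ᵥ P ⊆ P` then `X *ᵥ P ⊆ P` for all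
`X ∈ ℂ[M] = Algebra.adjoin ℂ {M}`. [folklore] -/
theorem mulVec_mem_of_mem_adjoin {M : Matrix (Fin d) (Fin d) ℂ} {P : Submodule ℂ (Fin d → ℂ)} (hMP : ∀ p ∈ P, M *ᵥ p ∈ P)
    {X : Matrix (Fin d) (Fin d) ℂ} (hX : X ∈ Algebra.adjoin ℂ ({M} : Set (Matrix (Fin d) (Fin d) ℂ))) :
    ∀ p ∈ P, X *ᵥ p ∈ P := by
  induction hX using Algebra.adjoin_induction with
  | mem x hx =>
    rw [Set.mem_singleton_iff] at hx
    subst hx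
    exact hMP
  | algebraMap r =>
    intro p hp
    rw [Algebra.algebraMap_eq_smul_one, Matrix.smul_mulVec, Matrix.one_mulVec]
    exact P.smul_mem r hp
  | add x y _ _ hx hy =>
    intro p hp
    rw [Matrix.add_mulVec]
    exact P.add_mem (hx p hp) (hy p hp)
  | mul x y _ _ hx hy =>
    intro p hp
    rw [← Matrix.mulVec_mulVec]
    exact hx _ (hy p hp)

/-- **`exp M` preserves every `M`-stable subspace of coordinate vectors** (`exp M ∈ ℂ[M]`, a finite-dimensional hence closed subalgebra — Mathlib
`NormedSpace.exp_mem`). [cite: Hall2015, Cor. 3.44] -/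
theorem exp_mulVec_mem {M : Matrix (Fin d) (Fin d) ℂ} {P : Submodule ℂ (Fin d → ℂ)} (hMP : ∀ p ∈ P, M *ᵥ p ∈ P) :
    ∀ p ∈ P, NormedSpace.exp M *ᵥ p ∈ P := by
  have hclosed : IsClosed ((Algebra.adjoin ℂ ({M} : Set (Matrix (Fin d) (Fin d) ℂ))) : Set (Matrix (Fin d) (Fin d) ℂ)) :=
    (Subalgebra.toSubmodule (Algebra.adjoin ℂ ({M} : Set (Matrix (Fin d) (Fin d) ℂ)))).closed_of_finiteDimensional
  have hexp : NormedSpace.exp M ∈ Algebra.adjoin ℂ ({M} : Set (Matrix (Fin d) (Fin d) ℂ)) :=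
    NormedSpace.exp_mem (R := ℂ) hclosed (Algebra.self_mem_adjoin_singleton ℂ M)
  exact mulVec_mem_of_mem_adjoin hMP hexp

end Coords

/-- **A `𝔨`-stable subspace is stable under `ρK(exp Y)`, `Y ∈ 𝔨`.** [cite: KnappVogan1995, §I.4 (1.64)–(1.65)] [cite: Hall2015, Cor. 3.44] -/
theorem ρK_expK_apply_mem_of_lieStable (h : IsGKModule G ρK ρ𝔤) {W : Submodule ℂ V}
    (hW : ∀ (Y : G.compactLie) (w : V), w ∈ W → ρ𝔤 (LieSubalgebra.inclusion G.compactLie_le_lie Y) w ∈ W)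
    (Y : G.compactLie) {w : V} (hw : w ∈ W) : ρK (G.expK Y) w ∈ W := by
  classical
  -- the finite-dimensional `K`-stable span of the orbit of `w`
  set F : Submodule ℂ V := Submodule.span ℂ (Set.range fun k : G.maximalCompact => ρK k w) with hFdef
  haveI : FiniteDimensional ℂ F := h.kFinite w
  have hF : ∀ (k : G.maximalCompact), ∀ u ∈ F, ρK k u ∈ F :=
    fun k u hu => Literature.RepresentationTheory.BorelWallach2000.GKWeights.kSpan_stable w k hu
  have hwF : w ∈ F := Literature.RepresentationTheory.BorelWallach2000.GKWeights.mem_kSpan w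
  set d := Module.finrank ℂ F
  let b : Module.Basis (Fin d) ℂ F := Module.finBasis ℂ F
  set T : V →ₗ[ℂ] V := (ρ𝔤 (LieSubalgebra.inclusion G.compactLie_le_lie Y) : V →ₗ[ℂ] V) with hT
  have hTF : ∀ u ∈ F, T u ∈ F := fun u hu => IsGKModule.apply_mem_of_K_stable_of_hasWeakDeriv h.hasWeakDeriv Y hF hu
  have hTW : ∀ u ∈ W, T u ∈ W := fun u hu => hW Y u hu
  -- the coordinate image of `W ∩ F` is `M`-stable, `M = mat b T`
  let P : Submodule ℂ (Fin d → ℂ) :=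
    { carrier := {p | ∃ x ∈ W ⊓ F, coords b x = p}
      add_mem' := by
        rintro _ _ ⟨x, hx, rfl⟩ ⟨y, hy, rfl⟩
        exact ⟨x + y, add_mem hx hy, coords_add b x y⟩
      zero_mem' := ⟨0, zero_mem _, by funext i; simp [coords]⟩
      smul_mem' := by
        rintro c _ ⟨x, hx, rfl⟩
        exact ⟨c • x, Submodule.smul_mem _ c hx, coords_smul b c x⟩ }
  have hMP : ∀ p ∈ P, mat b T *ᵥ p ∈ P := by
    rintro _ ⟨x, hx, rfl⟩
    refine ⟨T x, ⟨hTW x hx.1, hTF x hx.2⟩, ?_⟩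
    rw [mat_mulVec_coords b T hx.2]
  -- `coords (ρK (exp Y) w) = exp M *ᵥ coords w ∈ P`
  have hkey := coords_expK b h hF Y hwF
  have hmem : coords b (ρK (G.expK Y) w) ∈ P := by
    rw [hkey]
    exact exp_mulVec_mem hMP _ ⟨w, ⟨hw, hwF⟩, rfl⟩
  obtain ⟨x, hx, hxc⟩ := hmem
  have hxe : x = ρK (G.expK Y) w := eq_of_coords_eq b hx.2 (hF _ w hwF) hxc
  rw [← hxe]
  exact hx.1

/-- **A `𝔨`-stable subspace of a `(𝔤, K)`-module is `K`-stable when every element of `K` is an exponential** (`K = exp 𝔨`; for `U(α) × U(β) ⊂ U(α, β)`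
this is ★ `upq_exists_expK_eq`). [cite: KnappVogan1995, §I.4 (1.64)–(1.65)] [cite: BorelWallach2000, 0 §2.5] -/
theorem ρK_apply_mem_of_lieStable (h : IsGKModule G ρK ρ𝔤) (hK : ∀ k : G.maximalCompact, ∃ Y : G.compactLie, G.expK Y = k)
    {W : Submodule ℂ V} (hW : ∀ (Y : G.compactLie) (w : V), w ∈ W → ρ𝔤 (LieSubalgebra.inclusion G.compactLie_le_lie Y) w ∈ W) :
    ∀ (k : G.maximalCompact) (w : V), w ∈ W → ρK k w ∈ W := by
  intro k w hw
  obtain ⟨Y, rfl⟩ := hK k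
  exact ρK_expK_apply_mem_of_lieStable h hW Y hw

/-- The same, phrased as an `IsGKSubmodule`: a `𝔤`-stable subspace of a `(𝔤, K)`-module with `K = exp 𝔨` is a `(𝔤, K)`-submodule.
[cite: KnappVogan1995, §I.4 (1.64)–(1.65)] [cite: BorelWallach2000, 0 §2.5] -/
theorem isGKSubmodule_of_lieStable (h : IsGKModule G ρK ρ𝔤) (hK : ∀ k : G.maximalCompact, ∃ Y : G.compactLie, G.expK Y = k)
    {W : Submodule ℂ V} (hW : ∀ (X : G.lie) (w : V), w ∈ W → ρ𝔤 X w ∈ W) : IsGKSubmodule ρK ρ𝔤 W :=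
  ⟨ρK_apply_mem_of_lieStable h hK fun _ w hw => hW _ w hw, hW⟩

section Graph

variable {V' : Type*} [AddCommGroup V'] [Module ℂ V']
  {ρK' : Representation ℂ G.maximalCompact V'} {ρ𝔤' : G.lie →ₗ⁅ℝ⁆ Module.End ℂ V'}

/-- **THE GRAPH TRICK (relative form): a linear map that intertwines `𝔨` on a `𝔨`-stable subspace `U` intertwines `K = exp 𝔨` on `U`.**
For `(𝔤, K)`-modules `V`, `V'`, a `𝔨`-stable `U ≤ V` and `Φ : V →ₗ V'` with `Φ ∘ ρ𝔤(Y) = ρ𝔤'(Y) ∘ Φ` on `U` for `Y ∈ 𝔨`, the graph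
`{(u, Φ u) : u ∈ U}` is a `𝔨`-stable subspace of the `(𝔤, K)`-module `V × V'` (★ `GKRing.isGKModule_prod`), hence `K`-stable
(`ρK_apply_mem_of_lieStable`): `Φ (ρK k u) = ρK' k (Φ u)` for `u ∈ U`.  (For `U`, `U'` merely `𝔨`-stable — e.g. two `𝔨`-strings — ★
`map_ρK_of_lieEquiv` does not apply; this does.) [cite: KnappVogan1995, §I.4 (1.64)–(1.65), §I.6 after (1.87)] [cite: Hall2015, Cor. 3.44] -/
theorem map_ρK_of_lie_comm_on (h : IsGKModule G ρK ρ𝔤) (h' : IsGKModule G ρK' ρ𝔤')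
    (hK : ∀ k : G.maximalCompact, ∃ Y : G.compactLie, G.expK Y = k)
    {U : Submodule ℂ V} (hU : ∀ (Y : G.compactLie) (u : V), u ∈ U → ρ𝔤 (LieSubalgebra.inclusion G.compactLie_le_lie Y) u ∈ U)
    (Φ : V →ₗ[ℂ] V')
    (hΦ : ∀ (Y : G.compactLie) (u : V), u ∈ U →
      Φ (ρ𝔤 (LieSubalgebra.inclusion G.compactLie_le_lie Y) u) = ρ𝔤' (LieSubalgebra.inclusion G.compactLie_le_lie Y) (Φ u))
    (k : G.maximalCompact) {u : V} (hu : u ∈ U) : Φ (ρK k u) = ρK' k (Φ u) := by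
  -- the product `(𝔤, K)`-module `V × V'` over the operator ring
  let M := GKRing.asModule ρK ρ𝔤
  let P := GKRing.asModule ρK' ρ𝔤'
  let e₁ : M ≃ₗ[ℂ] V := GKRing.asModuleEquiv ρK ρ𝔤
  let e₂ : P ≃ₗ[ℂ] V' := GKRing.asModuleEquiv ρK' ρ𝔤'
  have hM : IsGKModule G (GKRing.actK G M) (GKRing.actLie G M) := (GKRing.isGKModule_asModule_iff ρK ρ𝔤).mpr h
  have hP : IsGKModule G (GKRing.actK G P) (GKRing.actLie G P) := (GKRing.isGKModule_asModule_iff ρK' ρ𝔤').mpr h'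
  have hprod : IsGKModule G (GKRing.actK G (M × P)) (GKRing.actLie G (M × P)) := GKRing.isGKModule_prod G M P hM hP
  -- the graph of `Φ` over `U`
  let W : Submodule ℂ (M × P) :=
    { carrier := {x | e₁ x.1 ∈ U ∧ e₂ x.2 = Φ (e₁ x.1)}
      add_mem' := by
        rintro x y ⟨hx, hx'⟩ ⟨hy, hy'⟩
        refine ⟨?_, ?_⟩
        · rw [Prod.fst_add, map_add]; exact add_mem hx hy
        · rw [Prod.snd_add, Prod.fst_add, map_add, map_add, map_add, hx', hy']
      zero_mem' := ⟨by rw [Prod.fst_zero, map_zero]; exact zero_mem U, by rw [Prod.snd_zero, Prod.fst_zero, map_zero, map_zero, map_zero]⟩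
      smul_mem' := by
        rintro c x ⟨hx, hx'⟩
        refine ⟨?_, ?_⟩
        · rw [Prod.smul_fst, map_smul]; exact U.smul_mem c hx
        · rw [Prod.smul_snd, Prod.smul_fst, map_smul, map_smul, map_smul, hx'] }
  have hW : ∀ (Y : G.compactLie) (x : M × P), x ∈ W →
      GKRing.actLie G (M × P) (LieSubalgebra.inclusion G.compactLie_le_lie Y) x ∈ W := by
    rintro Y x ⟨hx, hx'⟩
    refine ⟨?_, ?_⟩
    · rw [GKRing.actLie_prod_apply, GKRing.actLie_asModule_apply, LinearEquiv.apply_symm_apply]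
      exact hU Y _ hx
    · rw [GKRing.actLie_prod_apply, GKRing.actLie_asModule_apply, GKRing.actLie_asModule_apply, LinearEquiv.apply_symm_apply,
        LinearEquiv.apply_symm_apply, hx', hΦ Y _ hx]
  -- `(u, Φ u) ∈ W`, so `k • (u, Φ u) = (ρK k u, ρK' k (Φ u)) ∈ W`
  have hx₀ : ((e₁.symm u, e₂.symm (Φ u)) : M × P) ∈ W := by
    refine ⟨?_, ?_⟩
    · change e₁ (e₁.symm u) ∈ U
      rw [LinearEquiv.apply_symm_apply]; exact hu
    · change e₂ (e₂.symm (Φ u)) = Φ (e₁ (e₁.symm u))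
      rw [LinearEquiv.apply_symm_apply, LinearEquiv.apply_symm_apply]
  have hk := (ρK_apply_mem_of_lieStable hprod hK hW k _ hx₀).2
  change e₂ (GKRing.actK G (M × P) k _).2 = Φ (e₁ (GKRing.actK G (M × P) k _).1) at hk
  rw [GKRing.actK_prod_apply, GKRing.actK_asModule_apply, GKRing.actK_asModule_apply, LinearEquiv.apply_symm_apply,
    LinearEquiv.apply_symm_apply, LinearEquiv.apply_symm_apply, LinearEquiv.apply_symm_apply] at hk
  exact hk.symm

/-- **THE GRAPH TRICK (global form): a `𝔨`-intertwiner between `(𝔤, K)`-modules is a `K`-intertwiner when `K = exp 𝔨`** — any linear `Φ`,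
invertible or not (the invertible `𝔤`-equivariant case is ★ `map_ρK_of_lieEquiv`). [cite: KnappVogan1995, §I.4 (1.64)–(1.65), §I.6 after (1.87)]
[cite: Hall2015, Cor. 3.44] -/
theorem map_ρK_of_lie_comm (h : IsGKModule G ρK ρ𝔤) (h' : IsGKModule G ρK' ρ𝔤')
    (hK : ∀ k : G.maximalCompact, ∃ Y : G.compactLie, G.expK Y = k) (Φ : V →ₗ[ℂ] V')
    (hΦ : ∀ (Y : G.compactLie) (v : V),
      Φ (ρ𝔤 (LieSubalgebra.inclusion G.compactLie_le_lie Y) v) = ρ𝔤' (LieSubalgebra.inclusion G.compactLie_le_lie Y) (Φ v))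
    (k : G.maximalCompact) (v : V) : Φ (ρK k v) = ρK' k (Φ v) :=
  map_ρK_of_lie_comm_on h h' hK (U := ⊤) (fun _ _ _ => Submodule.mem_top) Φ (fun Y v _ => hΦ Y v) k Submodule.mem_top

end Graph

end IsGKModule

end Literature.NumberTheory.Automorphic

end
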